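import Summits.BirchSwinnertonDyer.Rank1Residual.ManinAdditive.InfinityCuspManin
import Summits.BirchSwinnertonDyer.Rank1Residual.ManinConstantOne
import HarnessLib

/-!
# Placement edges of the ES candidates of cell bsd-f2-manin (`InfinityCuspManin.lean`) — PROVED

* `maninUnitOfInfinityCuspWitness_of_collapse` : ES-1 ⟹ ES-2 (lattice bookkeeping: under the
  lattice clause `Λ_W = c·Λ_f` and `c ≠ 0`, `c·x ∈ Λ_W` forces `x ∈ Λ_f`);
* `maninUnitOfInfinityCuspWitness_of_maninConstantOne` : Manin's conjecture ⟹ ES-2 (the law is a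
  weakening of Manin on optimal data: `|c| = 1`).
Nothing else is claimed; no fact is introduced.
-/

noncomputable section

open scoped MatrixGroups ModularForm

open CongruenceSubgroup WeierstrassCurve
  Literature.NumberTheory.EllipticCurves Literature.NumberTheory.EllipticCurves.ModularForms
  Summit.BirchSwinnertonDyer.Rank1Residual.ManinConstant

namespace Summit.BirchSwinnertonDyer.Rank1Residual.ManinAdditive

/-- **ES-1 ⟹ ES-2.** If `p ∣ c` collapsed every ∞-side cusp symbol into `Λ_W = c·Λ_f`, then
cancelling `c ≠ 0` would put `{∞ → a/d}_f` in `Λ_f`, contradicting the witness. -/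
theorem maninUnitOfInfinityCuspWitness_of_collapse (h : InfinityCuspCollapseOfDvdManin) :
    ManinUnitOfInfinityCuspWitness := by
  intro W _ _ _ D p _ hΔ hc4 hc0 hopt hw hdvd
  obtain ⟨a, d, hdN, hpd, hcop, hnot⟩ := hw
  have hmem := h W D p hΔ hc4 hdvd a d hdN hpd hcop
  obtain ⟨w, hw, hEq⟩ := hopt _ hmem
  have hc : ((D.c : ℤ) : ℂ) ≠ 0 := by exact_mod_cast hc0
  have : modularSymbol D.f ((a : ℚ) / d) = w := by
    have hEq' : (D.c : ℂ) * modularSymbol D.f ((a : ℚ) / d) = (D.c : ℂ) * w := hEq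
    exact mul_left_cancel₀ hc hEq'
  exact hnot (this ▸ hw)

/-- **Manin ⟹ ES-2**: on lattice-optimal data of a globally minimal curve `|c| = 1`, so no prime
divides `c`. -/
theorem maninUnitOfInfinityCuspWitness_of_maninConstantOne (hM : ManinConstantOne) :
    ManinUnitOfInfinityCuspWitness := by
  intro W _ _ _ D p hp _ _ _ hopt _ hdvd
  have h1 : |D.maninConstant| = 1 := hM W D hopt
  have h2 : (p : ℤ) ∣ 1 := h1 ▸ (dvd_abs _ _).mpr hdvd
  have h3 : (p : ℤ) = 1 := Int.eq_one_of_dvd_one (by positivity) h2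
  exact hp.out.one_lt.ne' (by exact_mod_cast h3)

end Summit.BirchSwinnertonDyer.Rank1Residual.ManinAdditive

end
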